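import Summits.ResolutionOfSingularities.KangarooAtlas.MizutaniAttainedGeneralForms
import Summits.ResolutionOfSingularities.KangarooAtlas.MizutaniPDegree
import Summits.ResolutionOfSingularities.KangarooAtlas.MizutaniAttained
import HarnessLib

/-!
# Mizutani's `m(e)` — attainment over an ARBITRARY field, IV: `2p^e − 1` is attained iff `[k : k^p] ≥ p²`

Cell topic `Summits/ResolutionOfSingularities/KangarooAtlas` (pub-rosobs); namespaces
`Summit.ResolutionOfSingularities.KangarooAtlas.Mizutani.GenAtt` / `…Mizutani`.  Part of the Lean transcription of the
in-house note MIZUTANI-PROOF-g59 (AI-written, AI-audited; *AI review is weaker than expert review*; NOT a resolution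
theorem).  The note's Corollary 10.1, FIELD BY FIELD: "if `[𝕜 : 𝕜^p] ≥ p²` the value `2p^e − 1` is attained with
exponent exactly `e` (Mizutani's `H_e`) … for `[𝕜 : 𝕜^p] ≤ p` there is no scheme of exponent `≥ 1` at all".  With
parts I–III and `MizutaniPDegree.lean`:

* `GenAtt.exponentLE_attP`, `GenAtt.not_exponentLE_attP`, `GenAtt.hsDimAt_attP` — over every field `k` of
  characteristic `p` with a `p`-independent pair `u`, the point `attP k p e u` of `ℙ^{2p^e−1}_k` has exponent EXACTLY
  `e` and `dim B + 1 = 2p^e` (`e ≥ 1`);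
* `mizutaniAttained_of_pIndep` — hence the conclusion of `MizutaniAttained p e` holds WITH THE GIVEN FIELD `k`;
* `exists_pIndep_two_of_lt_rank` — `p < Module.rank (k^p) k` (i.e. `[k : k^p] > p`) yields a `p`-independent pair
  (two exchange steps, `PIndep.cons`);
* `mizutaniAttained_of_lt_rank` and the DICHOTOMY `exponent_dichotomy`: over `k`, either `Module.rank (k^p) k ≤ p` and
  every `B(𝔭)` is a vector group (`exponentLE_zero_of_rank_le`), or `[k : k^p] > p` and for every `e ≥ 1` some point of
  `ℙ^{2p^e−1}_k` has exponent exactly `e` and dimension `2p^e − 1` — the minimum allowed by `mizutaniLowerBound`.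

References: [Mizutani1973HironakaGroupSchemes] Remark 1.2, Remark 2.10, Example 2.1; in-house note Cor. 10.1;
[Oda1983HironakaGroupSchemeII] §2 (p. 1168).
-/

open MvPolynomial TensorProduct Literature.AlgebraicGeometry.Resolution
  Literature.AlgebraicGeometry.Resolution.HironakaScheme

namespace Summit.ResolutionOfSingularities.KangarooAtlas.Mizutani

universe u

namespace GenAtt

section Exponent

variable {k : Type u} [Field k] {p e : ℕ} [hp : Fact p.Prime] [CharP k p] {u : Fin 2 → k}

/-- **`exponent(B(attP)) ≤ e`** over every field with a `p`-independent pair: `(L_B)_{e+m}` has dimension `≤ 1`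
and contains the nonzero `F^m a⁰ ∈ k·F^m (L_B)_e`. [cite: Mizutani1973HironakaGroupSchemes, Remark 2.10 (e(H_e) = e)] -/
theorem exponentLE_attP (hu : PIndep p 1 u) (he : 1 ≤ e) : ExponentLE k p (attP k p e u) e := by
  refine exponentLE_of_finrank_le k p (attP k p e u) fun j hj => ?_
  obtain ⟨m, rfl⟩ := Nat.exists_eq_add_of_le hj
  rw [finrank_invForms_attP hu he]
  exact finrank_invForms_attP_le_one hu he m

omit [CharP k p] in
/-- `a⁰_{i₂} = −u_1` at the second distinguished index `i₂ = (1, q−2)` (encloser-1's `attTop'`). [folklore] -/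
theorem attA0_attTop' (he : 1 ≤ e) : attA0 k p e u (attTop' he) = -u 1 := by
  unfold attA0 attTop'
  rw [Equiv.apply_symm_apply]
  have : 2 ≤ p ^ e := le_trans hp.out.two_le (by
    calc p = p ^ 1 := (pow_one p).symm
      _ ≤ p ^ e := Nat.pow_le_pow_right hp.out.pos he)
  have hexp : p ^ e - 1 - (p ^ e - 2) = 1 := by omega
  simp [hexp]

/-- **`exponent(B(attP)) ≰ e − 1`**: otherwise `(L_B)_e = k · F (L_B)_{e−1}` is spanned by a vector of `p`-th powers
proportional to `a⁰`, and the coordinates `a⁰_{i*} = −1`, `a⁰_{i₂} = −u_1` give `u_1 ∈ k^p` — impossible for a member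
of a `p`-independent family.  Verbatim encloser-1's argument. [cite: Mizutani1973HironakaGroupSchemes, Remark 2.10 (e(H_e) = e exactly)] -/
theorem not_exponentLE_attP (hu : PIndep p 1 u) {e' : ℕ} (hee' : e = e' + 1) :
    ¬ ExponentLE k p (attP k p e u) e' := by
  have he : 1 ≤ e := by omega
  intro hE
  -- `(L_B)_e = k · F (L_B)_{e'}` and both are one-dimensional
  have heq : invForms k p (attP k p e u) e =
      Submodule.span k (frobVec k p 1 '' (invForms k p (attP k p e u) e' : Set (Fin (attN p e + 1) → k))) := by
    have := hE e (by omega)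
    rwa [show e - e' = 1 by omega] at this
  have hdim' : Module.finrank k (invForms k p (attP k p e u) e') = 1 := by
    rw [← finrank_span_frobVec_image k p 1, ← heq, finrank_invForms_attP hu he]
  obtain ⟨b, hb0, -⟩ := finrank_eq_one_iff'.mp hdim'
  -- `F b ∈ (L_B)_e ⊆ k · attV 0`, and `a⁰ ∈ k · attV 0`
  have hFb : frobVec k p 1 (b : Fin (attN p e + 1) → k) ∈ invForms k p (attP k p e u) e := by
    have := frobVec_one_mem_invForms k p (attP k p e u) attP_ne_top b.2
    rwa [← hee'] at this
  have hle := invForms_attP_le_span (k := k) (p := p) (e := e) hu he 0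
  obtain ⟨lam, hlam⟩ := Submodule.mem_span_singleton.mp (hle hFb)
  obtain ⟨mu, hmu⟩ := Submodule.mem_span_singleton.mp (hle attA0_mem_invForms)
  -- `F b ≠ 0`, `a⁰ ≠ 0`
  have hFb0 : frobVec k p 1 (b : Fin (attN p e + 1) → k) ≠ 0 := by
    intro h0
    apply hb0
    apply Subtype.ext
    funext i
    have := congrFun h0 i
    rw [frobVec_one_apply, Pi.zero_apply] at this
    exact (pow_eq_zero_iff hp.out.ne_zero).mp this
  have hmu0 : mu ≠ 0 := by
    rintro rfl; rw [zero_smul] at hmu; exact attA0_ne_zero hmu.symm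
  have hlam0 : lam ≠ 0 := by
    rintro rfl; rw [zero_smul] at hlam; exact hFb0 hlam.symm
  -- `F b = (lam/mu) • a⁰`
  have hprop : frobVec k p 1 (b : Fin (attN p e + 1) → k) = (lam * mu⁻¹) • attA0 k p e u := by
    rw [← hlam, ← hmu, smul_smul, mul_assoc, inv_mul_cancel₀ hmu0, mul_one]
  -- read the two coordinates
  have h1 := congrFun hprop attTop
  have h2 := congrFun hprop (attTop' he)
  rw [frobVec_one_apply, Pi.smul_apply, attA0_attTop, smul_eq_mul, mul_neg, mul_one] at h1
  rw [frobVec_one_apply, Pi.smul_apply, attA0_attTop' he, smul_eq_mul, mul_neg] at h2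
  have hb1 : (b : Fin (attN p e + 1) → k) attTop ≠ 0 := by
    intro h0
    rw [h0, zero_pow hp.out.ne_zero] at h1
    exact (mul_ne_zero hlam0 (inv_ne_zero hmu0)) (neg_eq_zero.mp h1.symm)
  have hu1 : u 1 = ((b : Fin (attN p e + 1) → k) (attTop' he) / (b : Fin (attN p e + 1) → k) attTop) ^ p := by
    rw [div_pow, h2, h1]
    field_simp
  exact not_mem_frobPow_of_pIndep hu 1 (mem_frobPow_iff.mpr ⟨_, by rw [pow_one]; exact hu1.symm⟩)

/-- **`dim B(attP) + 1 = 2q`** over every field with a `p`-independent pair (`dim B = (N+1) − dim_k (L_B)_e = 2q − 1`).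
[cite: Mizutani1973HironakaGroupSchemes, Remark 2.10 (dim H_e = 2p^e − 1)] -/
theorem hsDimAt_attP (hu : PIndep p 1 u) (he : 1 ≤ e) : hsDimAt k p (attP k p e u) e + 1 = 2 * p ^ e := by
  unfold hsDimAt
  rw [finrank_invForms_attP hu he, attN_succ]
  have : 1 ≤ p ^ e := Nat.one_le_pow _ _ hp.out.pos
  omega

end Exponent

end GenAtt

/-! ## Attainment over a given field -/

section General

variable (k : Type u) [Field k] (p : ℕ) [hp : Fact p.Prime] [CharP k p]

/-- **Attainment over every field with a `p`-independent pair** (note Cor. 10.1: "if `[𝕜 : 𝕜^p] ≥ p²` the value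
`2p^e − 1` is attained with exponent exactly `e`"): for `u : Fin 2 → k` `p`-independent and `e ≥ 1`, the point
`GenAtt.attP k p e u` of `ℙ^{2p^e − 1}_k` has exponent exactly `e` and `dim B + 1 = 2p^e` — i.e. the witness of
`MizutaniAttained p e` can be taken over the GIVEN field `k`.
[cite: Mizutani1973HironakaGroupSchemes, Remark 2.10 (the schemes H_e) and Example 2.1; in-house note Cor. 10.1] -/
theorem mizutaniAttained_of_pIndep {u : Fin 2 → k} (hu : PIndep p 1 u) {e : ℕ} (he : 1 ≤ e) :
    ∃ (n : ℕ) (𝔭 : Ideal (MvPolynomial (Fin (n + 1)) k)),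
      IsPoint k 𝔭 ∧ ExponentLE k p 𝔭 e ∧ (∀ e', e' < e → ¬ ExponentLE k p 𝔭 e') ∧ hsDimAt k p 𝔭 e + 1 = 2 * p ^ e := by
  obtain ⟨e', rfl⟩ : ∃ e', e = e' + 1 := ⟨e - 1, by omega⟩
  refine ⟨attN p (e' + 1), GenAtt.attP k p (e' + 1) u, GenAtt.isPoint_attP (GenAtt.ne_zero_of_pIndep hu),
    GenAtt.exponentLE_attP hu he, fun e'' he'' hE => ?_, GenAtt.hsDimAt_attP hu he⟩
  exact GenAtt.not_exponentLE_attP hu rfl (hE.mono (by omega))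

/-- If `[k^p(b) : k^p] = p^s < [k : k^p]` then some `y ∈ k` lies outside `k^p(b)`. [folklore] -/
theorem exists_not_mem_adjoin {s : ℕ} {b : Fin s → k} (hb : PIndep p 1 b)
    (hlt : (((p ^ 1) ^ s : ℕ) : Cardinal.{u}) < Module.rank (frobPow k p 1) k) :
    ∃ y : k, y ∉ IntermediateField.adjoin (frobPow k p 1) (Set.range b) := by
  by_contra hall
  push Not at hall
  have htop : IntermediateField.adjoin (frobPow k p 1) (Set.range b) = ⊤ :=
    eq_top_iff.mpr fun y _ => hall y
  have hfin := finrank_adjoin_eq (k := k) (p := p) (e := 1) hb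
  haveI : Module.Finite (frobPow k p 1) (towerField 1 b) :=
    Module.finite_of_finrank_pos (by rw [hfin]; exact pow_pos (pow_pos hp.out.pos 1) s)
  have hrank : Module.rank (frobPow k p 1) k = ((p ^ 1) ^ s : ℕ) := by
    rw [← IntermediateField.rank_top', ← hfin]
    show Module.rank (frobPow k p 1) (⊤ : IntermediateField (frobPow k p 1) k) =
      (Module.finrank (frobPow k p 1) (towerField 1 b) : Cardinal)
    rw [Module.finrank_eq_rank]
    unfold towerField
    rw [htop]
  rw [hrank] at hlt
  exact lt_irrefl _ hlt

/-- **`[k : k^p] > p` yields a `p`-independent pair** (two exchange steps `PIndep.cons`: `y_0 ∉ k^p`, then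
`y_1 ∉ k^p(y_0)`, which has degree `p`). [cite: Mizutani1973HironakaGroupSchemes, Lemma 2.4 (p. 88)] -/
theorem exists_pIndep_two_of_lt_rank (hk : (p : Cardinal.{u}) < Module.rank (frobPow k p 1) k) :
    ∃ u : Fin 2 → k, PIndep p 1 u := by
  have h0 : PIndep p 1 (Fin.elim0 : Fin 0 → k) := pIndep_empty 1 _
  obtain ⟨y₀, hy₀⟩ := exists_not_mem_adjoin k p h0 (by
    rw [pow_zero, Nat.cast_one]
    exact lt_trans (by exact_mod_cast hp.out.one_lt) hk)
  have h1 : PIndep p 1 (Fin.cons y₀ Fin.elim0 : Fin 1 → k) := h0.cons hy₀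
  obtain ⟨y₁, hy₁⟩ := exists_not_mem_adjoin k p h1 (by rw [pow_one, pow_one]; exact hk)
  exact ⟨Fin.cons y₁ (Fin.cons y₀ Fin.elim0), h1.cons hy₁⟩

/-- **Attainment over every field with `[k : k^p] > p`.** [cite: Mizutani1973HironakaGroupSchemes, Remark 2.10; in-house note Cor. 10.1 ("as soon as [k : k^p] ≥ p²")] -/
theorem mizutaniAttained_of_lt_rank (hk : (p : Cardinal.{u}) < Module.rank (frobPow k p 1) k) {e : ℕ}
    (he : 1 ≤ e) :
    ∃ (n : ℕ) (𝔭 : Ideal (MvPolynomial (Fin (n + 1)) k)),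
      IsPoint k 𝔭 ∧ ExponentLE k p 𝔭 e ∧ (∀ e', e' < e → ¬ ExponentLE k p 𝔭 e') ∧ hsDimAt k p 𝔭 e + 1 = 2 * p ^ e := by
  obtain ⟨u, hu⟩ := exists_pIndep_two_of_lt_rank k p hk
  exact mizutaniAttained_of_pIndep k p hu he

/-- **THE DICHOTOMY BY `p`-DEGREE** (note Cor. 10.1, field by field).  Over a field `k` of characteristic `p`, either
`Module.rank (k^p) k ≤ p` and EVERY point of every `ℙ^n_k` has a vector group as Hironaka scheme (exponent `0`), or
`[k : k^p] > p` and for EVERY `e ≥ 1` some point of `ℙ^{2p^e−1}_k` has exponent exactly `e` and the minimal dimension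
`2p^e − 1` of `mizutaniLowerBound`. [cite: Mizutani1973HironakaGroupSchemes, Remark 1.2 and Remark 2.10; in-house note Cor. 10.1] -/
theorem exponent_dichotomy :
    (Module.rank (frobPow k p 1) k ≤ p ∧
      ∀ (n : ℕ) (𝔭 : Ideal (MvPolynomial (Fin (n + 1)) k)), IsPoint k 𝔭 → ExponentLE k p 𝔭 0) ∨
    ((p : Cardinal.{u}) < Module.rank (frobPow k p 1) k ∧
      ∀ e, 1 ≤ e → ∃ (n : ℕ) (𝔭 : Ideal (MvPolynomial (Fin (n + 1)) k)),
        IsPoint k 𝔭 ∧ ExponentLE k p 𝔭 e ∧ (∀ e', e' < e → ¬ ExponentLE k p 𝔭 e') ∧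
          hsDimAt k p 𝔭 e + 1 = 2 * p ^ e) := by
  rcases le_or_gt (Module.rank (frobPow k p 1) k) p with hle | hlt
  · exact Or.inl ⟨hle, fun n 𝔭 hP => exponentLE_zero_of_rank_le k p 𝔭 hle hP⟩
  · exact Or.inr ⟨hlt, fun e he => mizutaniAttained_of_lt_rank k p hlt he⟩

/-- **A point of exponent `≥ 1` exists over `k` iff `[k : k^p] > p`** (iff `k` has a `p`-independent pair).
[cite: Mizutani1973HironakaGroupSchemes, Remark 1.2 and Remark 2.10; in-house note Cor. 10.1] -/
theorem exists_not_exponentLE_zero_iff :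
    (∃ (n : ℕ) (𝔭 : Ideal (MvPolynomial (Fin (n + 1)) k)), IsPoint k 𝔭 ∧ ¬ ExponentLE k p 𝔭 0) ↔
      (p : Cardinal.{u}) < Module.rank (frobPow k p 1) k := by
  constructor
  · rintro ⟨n, 𝔭, hP, h0⟩
    by_contra hle
    exact h0 (exponentLE_zero_of_rank_le k p 𝔭 (not_lt.mp hle) hP)
  · intro hlt
    obtain ⟨n, 𝔭, hP, -, hmin, -⟩ := mizutaniAttained_of_lt_rank k p hlt (le_refl 1)
    exact ⟨n, 𝔭, hP, hmin 0 Nat.one_pos⟩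

end General

end Summit.ResolutionOfSingularities.KangarooAtlas.Mizutani
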